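import Mathlib.LinearAlgebra.Matrix.ConjTranspose
import Mathlib.Data.Complex.Basic
import HarnessLib

/-!
# Compressed sesquilinear forms on a coordinate sector are determined by the matrix elements between columns

Elementary linear algebra used to pass from MATRIX ELEMENTS BETWEEN COLUMNS of a (rectangular) matrix `Φ` to the
compressed sesquilinear form on vectors supported on a set of column indices (a "sector"):
`⟨Φ φ', K Φ φ⟩ = ⟨φ', (Φᴴ K Φ) φ⟩` (`star_mulVec_dotProduct_mulVec_mulVec`), the entries of `Φᴴ K Φ` are the matrix
elements of `K` between the columns of `Φ`, and a sesquilinear form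
`⟨φ', B φ⟩` on vectors supported on `p` only sees the `p × p` block of `B` (`star_dotProduct_mulVec_eq_of_apply_eq_on`).
Hence: if `⟨Φ e_{σ'}, K Φ e_σ⟩ = A_{σ'σ}` for all `σ', σ` in the sector, then `⟨Φ φ', K Φ φ⟩ = ⟨φ', A φ⟩` for all
`φ, φ'` supported on the sector (`star_mulVec_dotProduct_mulVec_mulVec_of_cols`, and the variant `_neg` for the shape
`-(A + k·1)` of an effective Hamiltonian read off entrywise). This is the bookkeeping step that turns an entrywise
identification of Kato's second-order kernel between product states (Kato 1966, II-§2.2 (2.20); Tsai–Kivelson 2006,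
App. A (A1)) into the statement on a symmetry sector.

References: T. Kato, *Perturbation Theory for Linear Operators* (1966), II-§2.2; R. A. Horn, C. R. Johnson,
*Matrix Analysis* (2013), §0.2.5–0.2.7 (sesquilinear forms, block entries). All statements are [folklore].
-/

namespace Literature.MathematicalPhysics.QuantumLattice

open Matrix Finset

variable {m n : Type*} [Fintype m] [Fintype n]

/-- **`⟨Φ φ', K Φ φ⟩ = ⟨φ', (Φᴴ K Φ) φ⟩`.** [folklore] -/
theorem star_mulVec_dotProduct_mulVec_mulVec (Φ : Matrix m n ℂ) (K : Matrix m m ℂ) (φ φ' : n → ℂ) :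
    star (Φ *ᵥ φ') ⬝ᵥ (K *ᵥ (Φ *ᵥ φ)) = star φ' ⬝ᵥ ((Φᴴ * K * Φ) *ᵥ φ) := by
  rw [star_mulVec, ← dotProduct_mulVec, mulVec_mulVec, mulVec_mulVec, Matrix.mul_assoc]

omit [Fintype m] in
/-- **A sesquilinear form on vectors supported on `p` only sees the `p × p` block.** [folklore] -/
theorem star_dotProduct_mulVec_eq_of_apply_eq_on (B A : Matrix n n ℂ) (p : n → Prop)
    (h : ∀ σ' σ, p σ' → p σ → B σ' σ = A σ' σ)
    {φ φ' : n → ℂ} (hφ : ∀ σ, ¬ p σ → φ σ = 0) (hφ' : ∀ σ, ¬ p σ → φ' σ = 0) :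
    star φ' ⬝ᵥ (B *ᵥ φ) = star φ' ⬝ᵥ (A *ᵥ φ) := by
  simp only [dotProduct, mulVec, Pi.star_apply, Finset.mul_sum]
  refine Finset.sum_congr rfl fun σ' _ => Finset.sum_congr rfl fun σ _ => ?_
  by_cases hσ' : p σ'
  · by_cases hσ : p σ
    · rw [h σ' σ hσ' hσ]
    · rw [hφ σ hσ, mul_zero, mul_zero, mul_zero, mul_zero]
  · rw [hφ' σ' hσ', star_zero, zero_mul, zero_mul]

/-- **A compressed form on a coordinate sector is determined by the matrix elements between columns**: if
`⟨Φ e_{σ'}, K Φ e_σ⟩ = A_{σ'σ}` for all column indices `σ', σ` in the sector `p`, then `⟨Φ φ', K Φ φ⟩ = ⟨φ', A φ⟩`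
for all `φ, φ'` supported on `p`. [cite: Kato1966, II-§2.2 (2.20)] -/
theorem star_mulVec_dotProduct_mulVec_mulVec_of_cols (Φ : Matrix m n ℂ) (K : Matrix m m ℂ) (A : Matrix n n ℂ)
    (p : n → Prop)
    (h : ∀ σ' σ, p σ' → p σ → star (fun s => Φ s σ') ⬝ᵥ (K *ᵥ fun s => Φ s σ) = A σ' σ)
    {φ φ' : n → ℂ} (hφ : ∀ σ, ¬ p σ → φ σ = 0) (hφ' : ∀ σ, ¬ p σ → φ' σ = 0) :
    star (Φ *ᵥ φ') ⬝ᵥ (K *ᵥ (Φ *ᵥ φ)) = star φ' ⬝ᵥ (A *ᵥ φ) := by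
  rw [star_mulVec_dotProduct_mulVec_mulVec]
  refine star_dotProduct_mulVec_eq_of_apply_eq_on _ A p (fun σ' σ hσ' hσ => ?_) hφ hφ'
  -- the entries of `Φᴴ K Φ` are the matrix elements of `K` between the columns of `Φ`
  rw [← h σ' σ hσ' hσ, Matrix.mul_assoc, Matrix.mul_apply]
  refine Finset.sum_congr rfl fun t _ => ?_
  rw [conjTranspose_apply, Matrix.mul_apply, Pi.star_apply, mulVec, dotProduct]

/-- The same with an overall sign and a sector constant: if `⟨Φ e_{σ'}, K Φ e_σ⟩ = -(A_{σ'σ} + [σ' = σ] k)` on the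
sector, then `⟨Φ φ', K Φ φ⟩ = -⟨φ', (A + k·1) φ⟩` for `φ, φ'` supported on the sector — the shape of an effective
Hamiltonian `-(A + k)` read off entrywise (Tsai–Kivelson 2006, App. A (A1)). [cite: TsaiKivelson2006, App. A (A1)] -/
theorem star_mulVec_dotProduct_mulVec_mulVec_of_cols_neg [DecidableEq n] (Φ : Matrix m n ℂ) (K : Matrix m m ℂ)
    (A : Matrix n n ℂ) (k : ℂ) (p : n → Prop)
    (h : ∀ σ' σ, p σ' → p σ →
      star (fun s => Φ s σ') ⬝ᵥ (K *ᵥ fun s => Φ s σ) = -(A σ' σ + if σ' = σ then k else 0))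
    {φ φ' : n → ℂ} (hφ : ∀ σ, ¬ p σ → φ σ = 0) (hφ' : ∀ σ, ¬ p σ → φ' σ = 0) :
    star (Φ *ᵥ φ') ⬝ᵥ (K *ᵥ (Φ *ᵥ φ)) = -(star φ' ⬝ᵥ ((A + k • (1 : Matrix n n ℂ)) *ᵥ φ)) := by
  rw [star_mulVec_dotProduct_mulVec_mulVec_of_cols Φ K (-(A + k • (1 : Matrix n n ℂ))) p ?_ hφ hφ', neg_mulVec,
    dotProduct_neg]
  intro σ' σ hσ' hσ
  rw [h σ' σ hσ' hσ, Matrix.neg_apply, Matrix.add_apply, Matrix.smul_apply, Matrix.one_apply, smul_eq_mul, mul_ite,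
    mul_one, mul_zero]

end Literature.MathematicalPhysics.QuantumLattice
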